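import Summits.BirchSwinnertonDyer.BirchSwinnertonDyer.Theorems.GoldfeldAllTwistsTwoConverseTwinBirchTheoremB
import Summits.BirchSwinnertonDyer.BirchSwinnertonDyer.Theorems.GoldfeldAllTwistsTwoConverseTwinGenusOddMultipleWitnessNegTwo
import HarnessLib

set_option linter.dupNamespace false -- `…BirchSwinnertonDyer.BirchSwinnertonDyer…` is the cell's namespace (D-0017)
set_option autoImplicit false

/-!
# LINE B49 — THEOREM B′ (family F2, `d_K = −8q`), part I: the `K`-rational trace of `y(1)` is of ODD type over
# `K = ℚ(√−2q)`, and the index `[X₀(49)(K) : ℤP] = 2·|n|·(odd)`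

Cell `bsd-goldfeld`, seat `bsd-goldfeld-s1p-c301` (prover, gen 9); planner ruling g25 (cii) (THEOREM B′ = clause (ii) of
`X049BirchLemmaEvenDiscrEight` on the family F2 = `49a1^{(−2q)}`, `q ≡ 1 (mod 4)` prime, `(q/7) = −1`); scope memo
`HOME/GENUS-THEOREM-B-PRIME.md` factor F1. `--supports stmt-BirchSwinnertonDyer-19140` (route decl
`Theses.GoldfeldAllTwistsTwoConverse.BSDTwoCMSevenAdditiveRankOne`, twin″) as a HELPER; nothing here closes the item and BSD is
NOT proved by any of this. Theorems only; no named fact is consumed in this file (pure Galois descent and Mordell–Weil algebra).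
The F1 twin is `…TwinBirchTheoremB` §§1–2 (`d_K = −4q`, genus point `(0, i)`); here the genus point is `(−2, 1 + 2θ₀)`,
`θ₀² = −2`, over the genus field `H₀ = K(√q) = K(θ₀)` (seat c3 gen 8's F2 genus descent,
`cm7_odd_zsmul_ne_two_zsmul_add_of_genusData_negEight`).

* §1 `exists_ratTrace_oddType_negEight`: in the setting of seat c3's `not_isOfFinAddOrder_of_galoisData_negEight` (`q` prime,
  `(q/7) = −1`, `K` imaginary quadratic with `d_K = −8q`, `L/K` finite Galois with `r₀² = q`, `y₁ ∈ X₀(49)(L)`, the trace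
  relation `P = n • Σ_σ σ y₁`, and THEOREM A′ in Galois-sum currency) there is `P_K ∈ X₀(49)(K)` with `P = n • P_K` (the SAME
  `n`) and `P_K ∉ 2X₀(49)(K) + X₀(49)(K)_tors` — the witness construction re-run KEEPING `P_K` and `n` (the `∃ n`-form of
  clause (i) forgets both; memo §0 of `GENUS-THEOREM-B.md`).
* §2 `index_zmultiples_eq_of_oddType_of_torsionOrder`: `[X₀(49)(K) : ℤP] = |n·m|·2` with `m` ODD, for `P = n • P_K`, `P_K` of
  odd type, `rank X₀(49)(K) = 1` and `#X₀(49)(K)_tors = 2` (the torsion count is a HYPOTHESIS here; on F2 it is file B1c′'s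
  `torsionOrder_cm7_baseChange_eq_two_negEight`) — `KrizLi2019.index_zmultiples_eq` on `X₀(49)(K) ≅ ℤg ⊕ ℤ/2`.
References: [Gross1984] §§4–5; [Tian2014] §1 (1.3); [SilvermanAEC2009] VIII.6; [SilvermanTate2015] §3.5–3.6;
[Cox2013] §6.A Thm 6.1.
-/

noncomputable section

open scoped Classical

open scoped IntermediateField

open WeierstrassCurve NumberField Literature.NumberTheory Literature.NumberTheory.EllipticCurves
  Literature.NumberTheory.EllipticCurves.ModularForms

namespace Summit.BirchSwinnertonDyer.BirchSwinnertonDyer.Theorems.GoldfeldGoodTwists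

variable {K : Type} [Field K] [NumberField K]

/-! ## §1 The `K`-rational trace of `y(1)` is of ODD type over `K = ℚ(√−2q)` -/

section RatTraceNegEight

/-- **The `K`-rational trace and its odd type (family F2).** Let `q` be a prime with `(q/7) = −1`, `K` imaginary quadratic with
`d_K = −8q`, `P ∈ X₀(49)(K)`; `L/K` finite Galois with `r₀ ∈ L`, `r₀² = q`, and `y₁ ∈ X₀(49)(L)` with the TRACE RELATION
`P = n • Σ_{σ ∈ Gal(L/K)} σ y₁`; assume THEOREM A′ in Galois-sum currency: for some `(−2, y) ∈ X₀(49)(L)` and integers `μ`, `λ`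
odd, `μ • Σ_σ χ(σ)•σ y₁ − λ • (−2, y)` is torsion. Then there is `P_K ∈ X₀(49)(K)` with `P = n • P_K` (the SAME `n`) and
`P_K ∉ 2X₀(49)(K) + X₀(49)(K)_tors`: over `H₀ = K⟮r₀⟯` (degree `2`, `θ₀ = (y − 1)/2 ∈ H₀`, `θ₀² = −2`) the descended twisted
trace `y_χ`, the genus half-trace `Z` and `P_K ↦ y_χ + 2Z` satisfy the hypotheses of
`cm7_odd_zsmul_ne_two_zsmul_add_of_genusData_negEight`, and `K → H₀` is injective on points.
[cite: Gross1984, §§4–5] [cite: Tian2014, §1 (1.3)] [cite: Cox2013, §6.A Thm. 6.1] -/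
theorem exists_ratTrace_oddType_negEight (hK : IsImaginaryQuadratic K) {q : ℕ} (hq : q.Prime)
    (hq7 : jacobiSym q 7 = -1) (hdK : NumberField.discr K = -(8 * (q : ℤ))) (P : (cm7.baseChange K).toAffine.Point)
    {L : Type} [Field L] [CharZero L] [Algebra K L] [FiniteDimensional K L] [IsGalois K L]
    {r₀ : L} (hr : r₀ ^ 2 = algebraMap K L ((q : ℕ) : K))
    (y₁ : (cm7.baseChange L).toAffine.Point) {n : ℤ}
    (htr : Affine.Point.map (algebraMap K L).toRatAlgHom P =
      n • ∑ σ : L ≃ₐ[K] L, Affine.Point.map (σ : L →ₐ[K] L) y₁)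
    (hA : ∃ (y : L) (hy : (cm7.baseChange L).toAffine.Nonsingular (-2) y) (μ l : ℤ), Odd l ∧
      IsOfFinAddOrder (μ • (∑ σ : L ≃ₐ[K] L, (if σ r₀ = r₀ then (1 : ℤ) else -1) •
        Affine.Point.map (σ : L →ₐ[K] L) y₁) - l • Affine.Point.some (-2) y hy)) :
    ∃ PK : (cm7.baseChange K).toAffine.Point, P = n • PK ∧
      ∀ R t : (cm7.baseChange K).toAffine.Point, IsOfFinAddOrder t → PK ≠ (2 : ℤ) • R + t := by
  obtain ⟨y, hy, μ, l, hl, hAt⟩ := hA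
  -- the genus field `H₀ = K⟮r₀⟯`
  have hqK : ¬ IsSquare ((q : ℕ) : K) := not_isSquare_natCast_of_discr_eq_negEight hK hq hdK
  have hfin : Module.finrank K K⟮r₀⟯ = 2 := finrank_adjoin_sqrt_eq_two (L := L) hr hqK
  -- the three maps
  set fKL : (cm7.baseChange K).toAffine.Point →+ (cm7.baseChange L).toAffine.Point :=
    Affine.Point.map (W' := cm7) (algebraMap K L).toRatAlgHom with hfKL
  set fKH : (cm7.baseChange K).toAffine.Point →+ (cm7.baseChange K⟮r₀⟯).toAffine.Point :=
    Affine.Point.map (W' := cm7) (algebraMap K K⟮r₀⟯).toRatAlgHom with hfKH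
  set fHL : (cm7.baseChange K⟮r₀⟯).toAffine.Point →+ (cm7.baseChange L).toAffine.Point :=
    Affine.Point.map (W' := cm7) (algebraMap K⟮r₀⟯ L).toRatAlgHom with hfHL
  have hcomp : ∀ Q : (cm7.baseChange K).toAffine.Point, fHL (fKH Q) = fKL Q := by
    intro Q
    rw [hfHL, hfKH, Affine.Point.map_map]
    exact point_map_congr _ _ (fun x => (IsScalarTower.algebraMap_apply K K⟮r₀⟯ L x).symm) Q
  have hinjHL : Function.Injective fHL :=
    Affine.Point.map_injective (W' := cm7) ((algebraMap K⟮r₀⟯ L).toRatAlgHom)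
  -- `θ := (y − 1)/2 ∈ K⟮r₀⟯`: `θ = ± δ r₀ / (2q)` with `δ² = d_K = −8q` in `K`
  obtain ⟨δ, hδ, -, -⟩ := exists_sq_eq_discr_and_span hK
  have hδ2 : (algebraMap K L δ) ^ 2 = -(8 * (q : L)) := by
    rw [← map_pow, hδ, hdK]
    simp [map_neg, map_mul, map_ofNat, map_natCast]
  have hy8 : (y - 1) ^ 2 = -8 := sq_sub_one_eq_neg_eight_of_nonsingular_negTwo hy
  have hq0 : (q : L) ≠ 0 := by exact_mod_cast hq.ne_zero
  have hr' : r₀ ^ 2 = (q : L) := by rw [hr, map_natCast]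
  have hw2 : (2 * (algebraMap K L δ * r₀ / (2 * q))) ^ 2 = -8 := by
    rw [mul_pow, div_pow, mul_pow, hδ2, hr']
    field_simp
  have hθ_mem : (y - 1) / 2 ∈ K⟮r₀⟯ := by
    have hw_mem : algebraMap K L δ * r₀ / (2 * q) ∈ K⟮r₀⟯ := by
      refine div_mem (mul_mem (IntermediateField.algebraMap_mem _ δ)
        (IntermediateField.mem_adjoin_simple_self K r₀)) ?_
      exact_mod_cast (natCast_mem K⟮r₀⟯ (2 * q))
    rcases sq_eq_sq_iff_eq_or_eq_neg.mp (hy8.trans hw2.symm) with h | h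
    · have e : (y - 1) / 2 = algebraMap K L δ * r₀ / (2 * q) := by rw [h]; field_simp
      rw [e]; exact hw_mem
    · have e : (y - 1) / 2 = -(algebraMap K L δ * r₀ / (2 * q)) := by rw [h]; field_simp
      rw [e]; exact neg_mem hw_mem
  have hθL2 : ((y - 1) / 2) ^ 2 = (-2 : L) := by linear_combination hy8 / 4
  obtain ⟨θ₀, hθ₀⟩ : ∃ t : K⟮r₀⟯, t = ⟨(y - 1) / 2, hθ_mem⟩ := ⟨_, rfl⟩
  have hθ₀L : (θ₀ : L) = (y - 1) / 2 := by rw [hθ₀]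
  have hθ₀2' : θ₀ ^ 2 = algebraMap K K⟮r₀⟯ (-2) := by
    apply Subtype.ext
    simp [hθ₀L, hθL2, map_ofNat]
    norm_cast
  have hθ₀2 : θ₀ ^ 2 = -2 := by rw [hθ₀2', map_neg, map_ofNat]
  have hg : (cm7.baseChange K⟮r₀⟯).toAffine.Nonsingular (-2) (1 + 2 * θ₀) := by
    refine (Affine.equation_iff_nonsingular).mp ?_
    rw [Affine.equation_iff]
    simp [baseChange]
    linear_combination 4 * hθ₀2
  have hgi : fHL (Affine.Point.some (-2) (1 + 2 * θ₀) hg) = Affine.Point.some (-2) y hy := by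
    rw [hfHL, Affine.Point.map_some]
    have ey : (algebraMap K⟮r₀⟯ L).toRatAlgHom (1 + 2 * θ₀) = y := by
      rw [RingHom.toRatAlgHom_apply, map_add, map_one, map_mul, map_ofNat, IntermediateField.algebraMap_apply,
        hθ₀L]
      ring
    have ex : (algebraMap K⟮r₀⟯ L).toRatAlgHom (-2) = -2 := by
      rw [RingHom.toRatAlgHom_apply, map_neg, map_ofNat]
    simp only [ey, ex]
  -- the trace is `Gal(L/K)`-fixed, hence `K`-rational: `P = n • P_K`
  set T : (cm7.baseChange L).toAffine.Point := ∑ σ : L ≃ₐ[K] L, Affine.Point.map (σ : L →ₐ[K] L) y₁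
    with hT
  have hT' : T = ∑ σ : L ≃ₐ[K] L, (1 : ℤ) • Affine.Point.map (σ : L →ₐ[K] L) y₁ := by
    simp only [one_zsmul]; rfl
  obtain ⟨PK, hPK⟩ : ∃ PK : (cm7.baseChange K).toAffine.Point, fKL PK = T := by
    refine exists_map_eq_of_forall_map_galois_eq cm7 (k := K) fun τ => ?_
    rw [hT']
    exact map_sum_smul_map_eq_of_invariant cm7 τ (fun _ => (1 : ℤ)) (fun _ => rfl) y₁
  have hPn : P = n • PK := by
    apply Affine.Point.map_injective (W' := cm7) (f := (algebraMap K L).toRatAlgHom)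
    rw [map_zsmul]
    change fKL P = n • fKL PK
    rw [hPK, ← htr]
  -- descend the twisted trace and the genus half-trace to `K⟮r₀⟯`
  obtain ⟨yχ, hyχ⟩ := exists_map_adjoin_eq_twistedSum cm7 (k := K) hr y₁
  obtain ⟨Z, hZ⟩ := exists_map_adjoin_eq_genusHalfSum cm7 (k := K) hr y₁ 0 1
  have h2 : IsOfFinAddOrder (fKH PK - yχ - (2 : ℤ) • Z) := by
    have h0 : fKH PK - yχ - (2 : ℤ) • Z = 0 := by
      apply hinjHL
      rw [map_sub, map_sub, map_zsmul, map_zero, hcomp, hPK]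
      change T - fHL yχ - (2 : ℤ) • fHL Z = 0
      rw [hfHL, hyχ, hZ, hT, sum_map_sub_twistedSum_eq_two_smul cm7 r₀ y₁, sub_self]
    rw [h0]
    exact IsOfFinAddOrder.zero
  have h3 : IsOfFinAddOrder (μ • yχ - l • Affine.Point.some (-2) (1 + 2 * θ₀) hg) := by
    refine (hinjHL.isOfFinAddOrder_iff (f := fHL)).mp ?_
    rw [map_sub, map_zsmul, map_zsmul, hgi, hfHL, hyχ]
    exact hAt
  refine ⟨PK, hPn, fun R t ht hbad => ?_⟩
  -- the F2 genus descent lives in the classical instance world of an abstract `H₀`; at `H₀ = K⟮r₀⟯` (a subtype of `L`) the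
  -- point group of this file carries `Subtype`'s decidability, so the data are moved by `convert` (the `Decidable` instances
  -- are subsingletons), as in seat c3's `not_isOfFinAddOrder_of_galoisData_negEight` and F1's `exists_ratTrace_oddType`.
  have e : fKH PK = (2 : ℤ) • fKH R + fKH t := by rw [hbad, map_add, map_zsmul]
  have ht' : IsOfFinAddOrder (fKH t) := fKH.isOfFinAddOrder ht
  refine cm7_odd_zsmul_ne_two_zsmul_add_of_genusData_negEight hK hq hq7 hdK hfin hθ₀2 hg (y := fKH PK) (y' := yχ)
    (Z := Z) (μ := μ) (l := l) hl (by convert h2) (by convert h3) (k := 1) odd_one (fKH R) (fKH t)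
    (by convert ht') ?_
  convert e
  exact one_zsmul _

end RatTraceNegEight

/-! ## §2 The index `[X₀(49)(K) : ℤP] = 2·|n|·(odd)`, the torsion count as a hypothesis -/

section IndexNegEight

/-- **`[X₀(49)(K) : ℤP] = |n·m| · 2` with `m` ODD** for `P = n • P_K`, `P_K ∉ 2X₀(49)(K) + tors`, when `rank X₀(49)(K) = 1`
and `#X₀(49)(K)_tors = 2` (`X₀(49)(K)/tors = ℤḡ` by Mordell–Weil, `P_K ≡ m ḡ` with `m` odd; index formula
`KrizLi2019.index_zmultiples_eq`). F1's `index_zmultiples_eq_of_oddType` with the torsion count abstracted into the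
hypothesis `htK` (on F2, `K = ℚ(√−2q)`, it is `torsionOrder_cm7_baseChange_eq_two_negEight`).
[cite: SilvermanAEC2009, VIII.6] [cite: SilvermanTate2015, §3.5] -/
theorem index_zmultiples_eq_of_oddType_of_torsionOrder (htK : (cm7.baseChange K).torsionOrder = 2)
    (hr : (cm7.baseChange K).mordellWeilRank = 1) {P PK : (cm7.baseChange K).toAffine.Point} {n : ℤ}
    (hn : n ≠ 0) (hP : P = n • PK)
    (hodd : ∀ R t : (cm7.baseChange K).toAffine.Point, IsOfFinAddOrder t → PK ≠ (2 : ℤ) • R + t) :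
    ∃ m : ℤ, Odd m ∧ (AddSubgroup.zmultiples P).index = (n * m).natAbs * 2 := by
  -- a Mordell–Weil basis with ONE element
  obtain ⟨P₁, hP₁⟩ := (cm7.baseChange K).exists_isMordellWeilBasis_holds
  have hB : IsMordellWeilBasis (P₁ ∘ finCongr hr.symm) := isMordellWeilBasis_comp_equiv hP₁ _
  set g := (P₁ ∘ finCongr hr.symm) 0 with hg_def
  have hg : ¬ IsOfFinAddOrder g := by
    intro hfin
    have hne := hB.1.ne_zero 0
    apply hne
    change (QuotientAddGroup.mk g : mordellWeilModTorsion (cm7.baseChange K)) = 0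
    exact (QuotientAddGroup.eq_zero_iff _).mpr ((AddCommGroup.mem_torsion _).mpr hfin)
  have hgen : ∀ y : (cm7.baseChange K).toAffine.Point, ∃ m : ℤ,
      y - m • g ∈ AddCommGroup.torsion (cm7.baseChange K).toAffine.Point := fun y => by
    obtain ⟨a, ha⟩ := exists_sub_zsmul_isOfFinAddOrder_of_isMordellWeilBasis hB y
    exact ⟨a, (AddCommGroup.mem_torsion _).mpr ha⟩
  obtain ⟨m, hm⟩ := exists_sub_zsmul_isOfFinAddOrder_of_isMordellWeilBasis hB PK
  have hmodd : Odd m := odd_of_sub_zsmul_isOfFinAddOrder hodd hm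
  refine ⟨m, hmodd, ?_⟩
  have hm0 : m ≠ 0 := fun h => by simp [h] at hmodd
  have hx : P - (n * m) • g ∈ AddCommGroup.torsion (cm7.baseChange K).toAffine.Point := by
    rw [hP, mul_smul, ← smul_sub, AddCommGroup.mem_torsion]
    rw [← AddCommGroup.mem_torsion]
    exact AddSubgroup.zsmul_mem _ ((AddCommGroup.mem_torsion _).mpr hm) n
  rw [KrizLi2019.index_zmultiples_eq (cm7.baseChange K) hg hgen (mul_ne_zero hn hm0) hx, htK]

end IndexNegEight

end Summit.BirchSwinnertonDyer.BirchSwinnertonDyer.Theorems.GoldfeldGoodTwists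

end
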